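import Literature.AlgebraicGeometry.HilbertScheme.TransferOperatorSuperCommutators
import HarnessLib

/-!
# Lane (V), line v2p5 — stub S-A: Oberdieck's Cor. 3.5 in full SUPER form (odd operators allowed)

Cell `hodge-kum4`, crux stmt-Ventures-20141, registered stub `stub_superLie` of the v2p5 skeleton.  The tree's
`TransferOperatorSuperCommutators` proves `[T(φ), 𝔮ₘ(v)] = mᵗ 𝔮ₘ(φv)` and `[T(φ), T(ψ)] = T([φ,ψ])` for
parity-PRESERVING `φ, ψ` (even operators) and an even Casimir tensor.  The V2 mechanism needs the ODD generators
`m_x`, `|x|` odd (left cup product by an odd class), so this file redoes Oberdieck's computation for `φ` of an arbitrary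
parity `p` (`φ(A_j) ⊆` classes of parity `j + p`): the super-commutator picks up the Koszul sign `(−1)^{p|v|}`,
`T_t(φ) 𝔮ₘ(v) − (−1)^{p|v|} 𝔮ₘ(v) T_t(φ) = mᵗ 𝔮ₘ(φ v)`, and for `φ, ψ` of parities `p, p'`
`[T_t(φ), T_{t'}(ψ)} = T_{t+t'}([φ, ψ})` with `[X, Y} = XY − (−1)^{pp'} YX` (`HeisenbergFockSpace.superBracket`);
uniqueness is the super form of Lehn's cyclicity argument (`ext_of_superCommute`).  Geometric form: graded
endomorphisms of `H*(S(ℂ); ℂ)` of integer degrees `d`, `d'` (`IsOfDegree`), parities `|d|, |d'| mod 2`.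
Nothing here asserts L1-Hilb(n) / L1 / HC_Kum4Type / HC.
-/

noncomputable section

open DirectSum TensorProduct

namespace Summit.Ventures.HodgeKum4.L1Hilb

namespace SuperLie

open Literature.AlgebraicGeometry.HilbertScheme

universe u v w

variable {K : Type u} [Field K]
variable {A : ℕ → Type v} [∀ i, AddCommGroup (A i)] [∀ i, Module K (A i)]
variable {Φ : ℕ → ℕ → Type w} [∀ n i, AddCommGroup (Φ n i)] [∀ n i, Module K (Φ n i)]
variable {B : (⨁ i, A i) →ₗ[K] (⨁ i, A i) →ₗ[K] K} {q : ℤ → (⨁ i, A i) →ₗ[K] Module.End K (Fock Φ)}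
  {vac : Fock Φ}

/-- Sign bookkeeping: `(−1)^a = (−1)^b` when `a ≡ b (mod 2)`. -/
theorem neg_one_pow_eq_of_even_add {a b : ℕ} (h : Even (a + b)) : ((-1 : K) ^ a) = (-1) ^ b := by
  rcases Nat.even_or_odd a with ha | ha
  · have hb : Even b := by rw [Nat.even_add] at h; exact h.mp ha
    rw [ha.neg_one_pow, hb.neg_one_pow]
  · have hb : Odd b := by
      rw [Nat.even_add] at h
      exact Nat.not_even_iff_odd.mp fun hb ↦ (Nat.not_even_iff_odd.mpr ha) (h.mpr hb)
    rw [ha.neg_one_pow, hb.neg_one_pow]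

/-- **Super cyclicity/uniqueness.**  Two operators that agree on the vacuum and have the same "twisted commutators"
`X 𝔮ₘ(a) − s • 𝔮ₘ(a) X` with every homogeneous creation operator (for SOME scalars `s`, e.g. Koszul signs) are equal. -/
theorem ext_of_superCommute (h : IsHeisenbergRepresentation B q vac) {T T' : Module.End K (Fock Φ)}
    (hvac : T vac = T' vac) (s : ℕ → K)
    (hcomm : ∀ (m : ℤ), 0 < m → ∀ (k : ℕ) (a : A k),
      T * q m (lof K ℕ A k a) - s k • (q m (lof K ℕ A k a) * T) =
        T' * q m (lof K ℕ A k a) - s k • (q m (lof K ℕ A k a) * T')) : T = T' := by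
  have hW : LinearMap.ker (T - T') = ⊤ := by
    refine h.cyclic _ ?_ ?_
    · rw [LinearMap.mem_ker, LinearMap.sub_apply, hvac, sub_self]
    · intro m hm v x hx
      rw [LinearMap.mem_ker, LinearMap.sub_apply, sub_eq_zero] at hx ⊢
      induction v using DirectSum.induction_on with
      | zero => simp
      | add v w hv hw => rw [map_add, LinearMap.add_apply, map_add, map_add, hv, hw]
      | of k a =>
        rw [← DirectSum.lof_eq_of K]
        have h1 := LinearMap.congr_fun (hcomm m hm k a) x
        simp only [LinearMap.sub_apply, Module.End.mul_apply, LinearMap.smul_apply, hx] at h1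
        exact sub_left_injective h1
  refine LinearMap.ext fun x ↦ ?_
  have hx : x ∈ LinearMap.ker (T - T') := by rw [hW]; exact Submodule.mem_top
  rwa [LinearMap.mem_ker, LinearMap.sub_apply, sub_eq_zero] at hx

/-- **Core computation, parity `p`.**  For homogeneous `e ∈ A i`, `ε ∈ A j` with `i + j` even, homogeneous `γ ∈ A k`,
`φ` of parity `p` and `n, m > 0`:
`𝔮ₙ(φε)𝔮₋ₙ(e)𝔮ₘ(γ)x − (−1)^{pk} 𝔮ₘ(γ)𝔮ₙ(φε)𝔮₋ₙ(e)x = −δ_{n,m} m⟨e,γ⟩ 𝔮ₙ(φε)x`. -/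
theorem transfer_core_apply_parity (h : IsHeisenbergRepresentation B q vac)
    (hB : ∀ (i j : ℕ) (a : A i) (b : A j),
      B (lof K ℕ A i a) (lof K ℕ A j b) = (-1 : K) ^ (i * j) * B (lof K ℕ A j b) (lof K ℕ A i a))
    {p : ℕ} {φ : (⨁ i, A i) →ₗ[K] (⨁ i, A i)} (hφ : ∀ (j : ℕ) (ε : A j), φ (lof K ℕ A j ε) ∈ paritySpan K A (j + p))
    {i j k : ℕ} (hij : Even (i + j)) (e : A i) (ε : A j) (γ : A k) {n m : ℤ} (hn : 0 < n) (hm : 0 < m)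
    (x : Fock Φ) :
    q n (φ (lof K ℕ A j ε)) (q (-n) (lof K ℕ A i e) (q m (lof K ℕ A k γ) x)) -
        ((-1 : K) ^ (p * k)) • q m (lof K ℕ A k γ) (q n (φ (lof K ℕ A j ε)) (q (-n) (lof K ℕ A i e) x)) =
      if n = m then -(((m : K) * B (lof K ℕ A i e) (lof K ℕ A k γ)) • q n (φ (lof K ℕ A j ε)) x) else 0 := by
  -- the signs: `(−1)^{pk} (−1)^{k(j+p)} (−1)^{ki} = 1`
  have hs : ((-1 : K) ^ (p * k)) * (-1) ^ (k * (j + p)) * (-1) ^ (k * i) = 1 := by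
    rw [← pow_add, ← pow_add]
    refine Even.neg_one_pow ⟨p * k + k * ((i + j) / 2), ?_⟩
    obtain ⟨r, hr⟩ := hij
    rw [show (i + j) / 2 = r by omega]
    nlinarith [hr]
  -- (I') `𝔮ₘ(γ)` super-commutes with `𝔮ₙ(φε)` (`m + n ≠ 0`): parity of `φε` is `j + p`
  have h1 := h.bracket_apply_of_mem_paritySpan γ (hφ j ε) m n (q (-n) (lof K ℕ A i e) x)
  rw [if_neg (by omega), sub_eq_zero] at h1
  -- (II') `𝔮ₘ(γ)𝔮₋ₙ(e) = (−1)^{ki} 𝔮₋ₙ(e)𝔮ₘ(γ) + δ_{m,n} m⟨γ,e⟩`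
  have h2 := h.bracket_apply m (-n) k i γ e x
  rw [h1, sub_eq_iff_eq_add'.mp h2, map_add, map_smul, smul_add, smul_add, smul_smul, smul_smul, smul_smul, hs,
    one_smul, sub_add_cancel_left]
  by_cases hnm : n = m
  · subst hnm
    rw [if_pos (by omega), if_pos rfl, map_smul, smul_smul, hB k i γ e]
    have hsc : (-1 : K) ^ (p * k) * (-1) ^ (k * (j + p)) *
        ((n : K) * ((-1) ^ (k * i) * B (lof K ℕ A i e) (lof K ℕ A k γ))) = (n : K) * B (lof K ℕ A i e) (lof K ℕ A k γ) := by
      linear_combination ((n : K) * B (lof K ℕ A i e) (lof K ℕ A k γ)) * hs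
    rw [hsc]
  · rw [if_neg (by omega), if_neg hnm, map_zero, smul_zero, neg_zero]

/-- The transfer-term twisted commutator for an even tensor `C`, `φ` of parity `p` and a homogeneous `γ ∈ A k`:
`τₙ(φ)(𝔮ₘ(γ)x) − (−1)^{pk} 𝔮ₘ(γ)(τₙ(φ) x) = −δ_{n,m} m 𝔮ₘ(φ(Σᵢ⟨eᵢ,γ⟩εᵢ)) x`. -/
theorem transferTerm_superCommute_apply (h : IsHeisenbergRepresentation B q vac)
    (hB : ∀ (i j : ℕ) (a : A i) (b : A j),
      B (lof K ℕ A i a) (lof K ℕ A j b) = (-1 : K) ^ (i * j) * B (lof K ℕ A j b) (lof K ℕ A i a))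
    {C : (⨁ i, A i) ⊗[K] (⨁ i, A i)} (hCg : C ∈ evenTensorSpan K A)
    {p : ℕ} {φ : (⨁ i, A i) →ₗ[K] (⨁ i, A i)} (hφ : ∀ (j : ℕ) (ε : A j), φ (lof K ℕ A j ε) ∈ paritySpan K A (j + p))
    {n m : ℤ} (hn : 0 < n) (hm : 0 < m) {k : ℕ} (γ : A k) (x : Fock Φ) :
    transferTerm K q C φ n (q m (lof K ℕ A k γ) x) - ((-1 : K) ^ (p * k)) • q m (lof K ℕ A k γ) (transferTerm K q C φ n x) =
      if n = m then
        -(((m : K)) • q m (φ (TensorProduct.lift ((LinearMap.lsmul K (⨁ i, A i)).comp (B.flip (lof K ℕ A k γ))) C)) x)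
      else 0 := by
  induction hCg using Submodule.span_induction with
  | mem c hc =>
    obtain ⟨i, j, e, ε, hij, rfl⟩ := hc
    rw [transferTerm_tmul, TensorProduct.lift.tmul, Module.End.mul_apply, Module.End.mul_apply,
      transfer_core_apply_parity h hB hφ hij e ε γ hn hm x]
    by_cases hnm : n = m
    · subst hnm
      rw [if_pos rfl, if_pos rfl, LinearMap.comp_apply, LinearMap.flip_apply, LinearMap.lsmul_apply, map_smul,
        map_smul, LinearMap.smul_apply, smul_smul]
    · rw [if_neg hnm, if_neg hnm]
  | zero =>
    simp only [transferTerm, map_zero, LinearMap.zero_apply, sub_self, smul_zero, neg_zero]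
    split_ifs <;> rfl
  | add y y' _ _ hy hy' =>
    have hsplit : transferTerm K q (y + y') φ n = transferTerm K q y φ n + transferTerm K q y' φ n := by
      simp [transferTerm, map_add]
    rw [hsplit, LinearMap.add_apply, LinearMap.add_apply, map_add, smul_add,
      show ∀ a a' r r' : Fock Φ, a + a' - (r + r') = (a - r) + (a' - r') by intros; abel, hy, hy', map_add]
    split_ifs
    · rw [map_add, map_add, LinearMap.add_apply, smul_add, neg_add]
    · rw [add_zero]
  | smul c y _ hy =>
    have hsplit : transferTerm K q (c • y) φ n = c • transferTerm K q y φ n := by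
      simp [transferTerm, map_smul]
    rw [hsplit, LinearMap.smul_apply, LinearMap.smul_apply, map_smul, smul_comm ((-1 : K) ^ (p * k)) c, ← smul_sub, hy,
      map_smul]
    split_ifs
    · rw [map_smul, map_smul, LinearMap.smul_apply, smul_neg, smul_comm c]
    · rw [smul_zero]

/-- **Oberdieck's Lemma 3.4, parity `p`**: `T_t(φ) 𝔮ₘ(w) − (−1)^{pr} 𝔮ₘ(w) T_t(φ) = mᵗ 𝔮ₘ(φ w)` for `w` of pure
parity `r`, `φ` of parity `p`, an even Casimir tensor and `m > 0`. -/
theorem transferOp_superCommute [CharZero K] (h : IsHeisenbergRepresentation B q vac)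
    (hB : ∀ (i j : ℕ) (a : A i) (b : A j),
      B (lof K ℕ A i a) (lof K ℕ A j b) = (-1 : K) ^ (i * j) * B (lof K ℕ A j b) (lof K ℕ A i a))
    {C : (⨁ i, A i) ⊗[K] (⨁ i, A i)} (hCg : C ∈ evenTensorSpan K A) (hC : IsCasimir K B C) (t : ℤ)
    {p : ℕ} {φ : (⨁ i, A i) →ₗ[K] (⨁ i, A i)} (hφ : ∀ (j : ℕ) (ε : A j), φ (lof K ℕ A j ε) ∈ paritySpan K A (j + p))
    {m : ℤ} (hm : 0 < m) {r : ℕ} {w : ⨁ i, A i} (hw : w ∈ paritySpan K A r) :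
    transferOp K q C t φ * q m w - ((-1 : K) ^ (p * r)) • (q m w * transferOp K q C t φ) =
      ((m : K) ^ t) • q m (φ w) := by
  induction hw using Submodule.span_induction with
  | zero => simp only [map_zero, mul_zero, zero_mul, smul_zero]; abel
  | add v v' _ _ hv hv' =>
    simp only [map_add, mul_add, add_mul, smul_add]
    rw [← hv, ← hv']
    abel
  | smul c v _ hv =>
    simp only [map_smul, mul_smul_comm, smul_mul_assoc]
    rw [smul_comm ((m : K) ^ t) c, ← hv]
    refine LinearMap.ext fun x ↦ ?_
    simp only [LinearMap.sub_apply, LinearMap.smul_apply, Module.End.mul_apply, smul_sub, smul_comm c]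
  | mem v hv =>
  obtain ⟨k, γ, hkr, rfl⟩ := hv
  -- replace the sign `(−1)^{pr}` by `(−1)^{pk}`
  rw [show ((-1 : K) ^ (p * r)) = (-1) ^ (p * k) from
    neg_one_pow_eq_of_even_add (by rw [← mul_add]; exact (by rwa [add_comm] at hkr : Even (r + k)).mul_left p)]
  obtain ⟨m', rfl⟩ := Int.eq_ofNat_of_zero_le hm.le
  have hm' : 1 ≤ m' := by exact_mod_cast hm
  have hm0 : (m' : K) ≠ 0 := by exact_mod_cast (show m' ≠ 0 by omega)
  push_cast
  refine DirectSum.linearMap_ext K fun p₀ ↦ LinearMap.ext fun y ↦ ?_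
  simp only [LinearMap.coe_comp, Function.comp_apply, LinearMap.sub_apply, Module.End.mul_apply,
    LinearMap.smul_apply]
  rw [show (lof K ℕ (fun n ↦ FockSummand Φ n) p₀) y = Fock.ofSummand K Φ p₀ y from rfl]
  obtain ⟨z, hz⟩ :=
    h.apply_ofSummand_mem_range (m' : ℤ) (lof K ℕ A k γ) (p := p₀) (p' := p₀ + m') (by push_cast; ring) y
  rw [← hz, h.transferOp_apply_ofSummand_of_le C t φ le_rfl z,
    h.transferOp_apply_ofSummand_of_le C t φ (Nat.le_add_right p₀ m') y, hz, map_neg, map_sum, smul_neg,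
    sub_neg_eq_add, neg_add_eq_sub, Finset.smul_sum, ← Finset.sum_sub_distrib]
  have hterm : ∀ n ∈ Finset.Icc 1 (p₀ + m'),
      ((-1 : K) ^ (p * k)) • q (m' : ℤ) (lof K ℕ A k γ) (((n : K) ^ (t - 1)) • transferTerm K q C φ (n : ℤ) (Fock.ofSummand K Φ p₀ y)) -
          ((n : K) ^ (t - 1)) •
            transferTerm K q C φ (n : ℤ) (q (m' : ℤ) (lof K ℕ A k γ) (Fock.ofSummand K Φ p₀ y)) =
        if n = m' then ((m' : K) ^ t) • q (m' : ℤ) (φ (lof K ℕ A k γ)) (Fock.ofSummand K Φ p₀ y) else 0 := by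
    intro n hn
    have hn1 : (0 : ℤ) < n := by
      simp only [Finset.mem_Icc] at hn
      exact_mod_cast hn.1
    have hc := transferTerm_superCommute_apply h hB hCg hφ hn1 hm γ (Fock.ofSummand K Φ p₀ y)
    simp only [hC (lof K ℕ A k γ), Int.cast_natCast, Nat.cast_inj] at hc
    rw [map_smul, smul_comm, ← smul_sub, show ∀ a b : Fock Φ, a - b = -(b - a) from fun a b ↦ (neg_sub b a).symm, hc]
    by_cases hnm : n = m'
    · subst hnm
      rw [if_pos rfl, if_pos rfl, neg_neg, smul_smul, ← zpow_add_one₀ hm0, sub_add_cancel]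
    · rw [if_neg hnm, if_neg hnm, neg_zero, smul_zero]
  rw [Finset.sum_congr rfl hterm, Finset.sum_ite_eq' (Finset.Icc 1 (p₀ + m')) m', if_pos (by simp [hm'])]

/-- Parity-`p` maps send classes of parity `r` to classes of parity `r + p`. -/
theorem map_mem_paritySpan_parity {p : ℕ} {φ : (⨁ i, A i) →ₗ[K] (⨁ i, A i)}
    (hφ : ∀ (j : ℕ) (ε : A j), φ (lof K ℕ A j ε) ∈ paritySpan K A (j + p)) {r : ℕ} {w : ⨁ i, A i}
    (hw : w ∈ paritySpan K A r) : φ w ∈ paritySpan K A (r + p) := by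
  induction hw using Submodule.span_induction with
  | mem w hw =>
    obtain ⟨j, b, hjr, rfl⟩ := hw
    rw [paritySpan_eq_of_even (show Even ((r + p) + (j + p)) from ⟨(r + j) / 2 + p, by
      obtain ⟨c, hc⟩ := hjr; omega⟩)]
    exact hφ j b
  | zero => rw [map_zero]; exact Submodule.zero_mem _
  | add w w' _ _ hw hw' => rw [map_add]; exact Submodule.add_mem _ hw hw'
  | smul c w _ hw => rw [map_smul]; exact Submodule.smul_mem _ c hw

/-- **Oberdieck's Cor. 3.5, full SUPER form**: `[T_t(φ), T_{t'}(ψ)} = T_{t+t'}([φ, ψ})` for `φ, ψ` of parities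
`p, p'`, super-brackets with the sign `(−1)^{pp'}`, an even Casimir tensor and a graded-symmetric pairing. -/
theorem transferOp_superLie [CharZero K] (h : IsHeisenbergRepresentation B q vac)
    (hB : ∀ (i j : ℕ) (a : A i) (b : A j),
      B (lof K ℕ A i a) (lof K ℕ A j b) = (-1 : K) ^ (i * j) * B (lof K ℕ A j b) (lof K ℕ A i a))
    {C : (⨁ i, A i) ⊗[K] (⨁ i, A i)} (hCg : C ∈ evenTensorSpan K A) (hC : IsCasimir K B C) (t t' : ℤ)
    {p p' : ℕ} {φ ψ : (⨁ i, A i) →ₗ[K] (⨁ i, A i)}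
    (hφ : ∀ (j : ℕ) (ε : A j), φ (lof K ℕ A j ε) ∈ paritySpan K A (j + p))
    (hψ : ∀ (j : ℕ) (ε : A j), ψ (lof K ℕ A j ε) ∈ paritySpan K A (j + p')) :
    superBracket K (transferOp K q C t φ) (transferOp K q C t' ψ) p p' =
      transferOp K q C (t + t') (superBracket K φ ψ p p') := by
  -- `[φ, ψ}` has parity `p + p'`
  have hχ : ∀ (j : ℕ) (ε : A j), (superBracket K φ ψ p p') (lof K ℕ A j ε) ∈ paritySpan K A (j + (p + p')) := by
    intro j ε
    rw [superBracket, LinearMap.sub_apply, LinearMap.smul_apply, Module.End.mul_apply, Module.End.mul_apply]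
    refine Submodule.sub_mem _ ?_ (Submodule.smul_mem _ _ ?_)
    · have := map_mem_paritySpan_parity hφ (hψ j ε); rwa [add_assoc, add_comm p' p] at this
    · have := map_mem_paritySpan_parity hψ (hφ j ε); rwa [add_assoc] at this
  refine ext_of_superCommute h ?_ (fun k ↦ (-1 : K) ^ ((p + p') * k)) ?_
  · rw [superBracket, LinearMap.sub_apply, LinearMap.smul_apply, Module.End.mul_apply, Module.End.mul_apply,
      transferOp_vac h C t' ψ, transferOp_vac h C t φ, map_zero, map_zero, smul_zero, sub_self,
      transferOp_vac h C (t + t')]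
  · intro m hm k γ
    have hm0 : (m : K) ≠ 0 := by exact_mod_cast hm.ne'
    have hγ : lof K ℕ A k γ ∈ paritySpan K A k := lof_mem_paritySpan ⟨k, rfl⟩ γ
    -- the four twisted commutators
    have e1 := fun x ↦ LinearMap.congr_fun (transferOp_superCommute h hB hCg hC t hφ hm hγ) x
    have e2 := fun x ↦ LinearMap.congr_fun (transferOp_superCommute h hB hCg hC t' hψ hm hγ) x
    have e3 := fun x ↦ LinearMap.congr_fun
      (transferOp_superCommute h hB hCg hC t hφ hm (map_mem_paritySpan_parity hψ hγ)) x
    have e4 := fun x ↦ LinearMap.congr_fun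
      (transferOp_superCommute h hB hCg hC t' hψ hm (map_mem_paritySpan_parity hφ hγ)) x
    have e5 := fun x ↦ LinearMap.congr_fun (transferOp_superCommute h hB hCg hC (t + t') hχ hm hγ) x
    simp only [LinearMap.sub_apply, Module.End.mul_apply, LinearMap.smul_apply] at e1 e2 e3 e4 e5
    refine LinearMap.ext fun x ↦ ?_
    set Tφ := transferOp K q C t φ
    set Tψ := transferOp K q C t' ψ
    have lhs_unfold : superBracket K Tφ Tψ p p' = Tφ * Tψ - ((-1 : K) ^ (p * p')) • (Tψ * Tφ) := rfl
    rw [lhs_unfold]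
    simp only [LinearMap.sub_apply, Module.End.mul_apply, LinearMap.smul_apply]
    rw [e5 x, show q m ((superBracket K φ ψ p p') (lof K ℕ A k γ)) x =
      q m (φ (ψ (lof K ℕ A k γ))) x - ((-1 : K) ^ (p * p')) • q m (ψ (φ (lof K ℕ A k γ))) x by
        simp only [superBracket, LinearMap.sub_apply, LinearMap.smul_apply, Module.End.mul_apply, map_sub, map_smul]]
    -- signs
    have s1 : ((-1 : K) ^ (p * (k + p'))) = (-1) ^ (p * k) * (-1) ^ (p * p') := by rw [← pow_add, mul_add]
    have s2 : ((-1 : K) ^ (p' * (k + p))) = (-1) ^ (p' * k) * (-1) ^ (p * p') := by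
      rw [← pow_add, mul_add, mul_comm p' p]
    have s3 : ((-1 : K) ^ ((p + p') * k)) = (-1) ^ (p * k) * (-1) ^ (p' * k) := by rw [← pow_add, add_mul]
    rw [sub_eq_iff_eq_add'.mp (e2 x), map_add, map_smul, map_smul, sub_eq_iff_eq_add'.mp (e1 (Tψ x)),
      sub_eq_iff_eq_add'.mp (e3 x), sub_eq_iff_eq_add'.mp (e1 x), map_add, map_smul, map_smul,
      sub_eq_iff_eq_add'.mp (e2 (Tφ x)), sub_eq_iff_eq_add'.mp (e4 x), s1, s2, s3, map_sub, map_smul, zpow_add₀ hm0]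
    rcases neg_one_pow_eq_or K (p * p') with hε | hε <;>
      simp only [hε, one_smul, neg_smul, smul_neg, one_mul, mul_one, neg_mul, mul_neg, neg_neg, smul_add, smul_sub,
        smul_smul, sub_neg_eq_add] <;>
      simp only [mul_comm] <;> abel

end SuperLie

/-! ### Geometric form: graded endomorphisms of `H*(S(ℂ); ℂ)` of any integer degree -/

section Geometric

open Literature.AlgebraicTopology.SingularHomology
open Literature.AlgebraicGeometry Literature.AlgebraicGeometry.Hyperkaehler Literature.AlgebraicGeometry.HilbertScheme
open Literature.AlgebraicGeometry.Motives (ComplexPoints SchemeOver IsSmoothProjective)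

/-- A graded endomorphism of degree `d ∈ ℤ` sends `Hʲ` into the classes of parity `j + |d|`. -/
theorem IsOfDegree.mem_paritySpan_natAbs {Y : Type} [TopologicalSpace Y] {φ : Module.End ℂ (totalCohomology ℂ Y)}
    {d : ℤ} (hφ : IsOfDegree ℂ Y φ d) (j : ℕ) (ε : singularCohomology ℂ ℂ Y j) :
    φ (ofDegree ℂ Y j ε) ∈ paritySpan ℂ (fun k ↦ singularCohomology ℂ ℂ Y k) (j + d.natAbs) := by
  have hmem := hφ j ε
  unfold shiftedPart at hmem
  split_ifs at hmem with hj
  · obtain ⟨y, hy⟩ := hmem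
    rw [← hy]
    refine lof_mem_paritySpan (A := fun k ↦ singularCohomology ℂ ℂ Y k) ?_ y
    have hcast : (((j : ℤ) + d).toNat : ℤ) = j + d := Int.toNat_of_nonneg hj
    rcases le_or_gt 0 d with hd | hd
    · refine ⟨j + d.natAbs, ?_⟩
      zify
      rw [hcast, abs_of_nonneg hd]
    · refine ⟨j, ?_⟩
      zify
      rw [hcast, abs_of_neg hd]
      ring
  · rw [Submodule.mem_bot] at hmem
    rw [hmem]
    exact Submodule.zero_mem _

end Geometric

open Literature.AlgebraicTopology.SingularHomology
open Literature.AlgebraicGeometry Literature.AlgebraicGeometry.Hyperkaehler Literature.AlgebraicGeometry.HilbertScheme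
open Literature.AlgebraicGeometry.Motives (ComplexPoints SchemeOver IsSmoothProjective) in
variable {S : SchemeOver ℂ} {hS : IsSmoothProjective 2 S} {H : HilbertSchemesOfPoints S} in
/-- (S-A) **Super Oberdieck Cor. 3.5** — registered stub `stub_superLie` of the v2p5 skeleton of crux stmt-Ventures-20141:
for graded endomorphisms `φ`, `ψ` of `H*(S)` of integer degrees `d`, `d'` (any parity), an even Casimir tensor `C` of the
Poincaré pairing and `t, t' ∈ ℤ`: `[T_t(φ), T_{t'}(ψ)} = T_{t+t'}([φ, ψ})` with the signs `(−1)^{|d||d'|}`. -/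
theorem stub_superLie (𝔑 : NakajimaOperators hS H)
    {C : totalCohomology ℂ (ComplexPoints S) ⊗[ℂ] totalCohomology ℂ (ComplexPoints S)}
    (hCg : C ∈ evenTensorSpan ℂ (coeffFamily S)) (hC : IsCasimir ℂ (poincarePairing hS) C) (t t' : ℤ)
    {φ ψ : Module.End ℂ (totalCohomology ℂ (ComplexPoints S))} {d d' : ℤ}
    (hφ : IsOfDegree ℂ (ComplexPoints S) φ d) (hψ : IsOfDegree ℂ (ComplexPoints S) ψ d') :
    superBracket ℂ (transferOp ℂ 𝔑.q C t φ) (transferOp ℂ 𝔑.q C t' ψ) d.natAbs d'.natAbs =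
      transferOp ℂ 𝔑.q C (t + t') (superBracket ℂ φ ψ d.natAbs d'.natAbs) :=
  SuperLie.transferOp_superLie 𝔑.isHeisenberg (poincarePairing_graded_symm hS) hCg hC t t'
    (IsOfDegree.mem_paritySpan_natAbs hφ) (IsOfDegree.mem_paritySpan_natAbs hψ)


end Summit.Ventures.HodgeKum4.L1Hilb

end
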